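import Summits.QuantumAdvantage.AdviceFreeQNC0.ProductGame
import Mathlib.LinearAlgebra.Dual.Lemmas
import HarnessLib

/-!
# Cell qa-qnc0 — the augmented elimination code `C⁺_L(d)` of line `tensor`: linear structure and parity

Planner qa-qnc0-p2's line `tensor` of the route crux `RingToElim` works with the AUGMENTED
ELIMINATION CODE `C⁺_L(d) = C_L(d) ⊕ ⟨𝟙⟩`: Boolean functions on `{0,1}^L` that are piecewise of
`𝔽₂`-degree `≤ d` on the three residue classes of `|u| mod 3`, the pieces summing to a constant
(`InCPlus`, verbatim from the registered skeleton, with `hw`, `xorM`, `ColsIn`, `RowsIn`). This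
file supplies the linear algebra behind `stub_coset` (ROUND-1 §9.27), PROVED:

* `cplus L d`, `code L d` — `C⁺` and `C` as submodules of `𝔽₂^{{0,1}^L}`; `one_mem_cplus`,
  `mem_cplus_iff` (`f ∈ C⁺ ↔ f ∈ C ∨ f + 𝟙 ∈ C`);
* `odd_coset_heavy` — under the crux hypothesis `ElimHard` every word of the odd coset `𝟙 + C_L(d)`
  (`d ≤ (log₂ L)^C`, `L ≥ n₀`) has weight `≥ η₀·2^L` (decoder `(0,·) ↦ 0, (1,0) ↦ 1, (1,1) ↦ 2`);
  in particular `𝟙 ∉ C` (`one_notMem_code`);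
* `exists_parity` — a linear functional `φ` with `φ(C) = 0`, `φ(𝟙) = 1` (dual of the quotient), and
  `parity_zero_iff` / `parity_one_iff` (`φ f = 0 ↔ f ∈ C`, `φ f = 1 ↔ f + 𝟙 ∈ C` on `C⁺`);
* `functional_of_cols_mem` — applying a functional to the columns of a matrix whose rows lie in a
  submodule `S` gives an element of `S` (`φ(col_v) = Σ_u φ(δ_u)·row_u(v)`);
* (sequel `AugmentedCodePatterns.lean`: win patterns lie in `C`, fail patterns in `𝟙 + C`,
  `InCPlus` functions in `C⁺`.)
-/

namespace Summit.QuantumAdvantage.AdviceFreeQNC0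

open Finset Literature.Computability.MetaComplexity Literature.Computability.MetaComplexity.Smolensky

variable {L : ℕ}

/-! ### Vocabulary (verbatim from line `tensor`) -/

/-- membership in the AUGMENTED ELIMINATION CODE `C⁺_L(d) = C_L(d) ⊕ ⟨𝟙⟩`: piecewise
`GF(2)`-degree `≤ d` on the three residue classes of `|u| mod 3`, the three pieces summing to a
constant. -/
def InCPlus {L : ℕ} (d : ℕ) (f : (Fin L → Bool) → Bool) : Prop :=
  ∃ Q₀ Q₁ Q₂ : (Fin L → Bool) → Bool, HasDeg Q₀ d ∧ HasDeg Q₁ d ∧ HasDeg Q₂ d ∧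
    (∃ e : Bool, ∀ u, xor (Q₀ u) (xor (Q₁ u) (Q₂ u)) = e) ∧
    ∀ u, f u = (if wt u % 3 = 0 then Q₀ u else if wt u % 3 = 1 then Q₁ u else Q₂ u)

/-- Hamming weight of a Boolean matrix on `{0,1}^L × {0,1}^{L'}`. -/
def hw {L L' : ℕ} (X : (Fin L → Bool) → (Fin L' → Bool) → Bool) : ℕ :=
  (univ.filter fun p : (Fin L → Bool) × (Fin L' → Bool) => X p.1 p.2 = true).card

/-- entrywise sum of two Boolean matrices. -/
def xorM {L L' : ℕ} (X Y : (Fin L → Bool) → (Fin L' → Bool) → Bool) :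
    (Fin L → Bool) → (Fin L' → Bool) → Bool :=
  fun u v => xor (X u v) (Y u v)

/-- every column (a function of `u`) lies in `C⁺_L(d)`. -/
def ColsIn {L L' : ℕ} (d : ℕ) (X : (Fin L → Bool) → (Fin L' → Bool) → Bool) : Prop :=
  ∀ v, InCPlus d (fun u => X u v)

/-- every row (a function of `v`) lies in `C⁺_{L'}(d)`. -/
def RowsIn {L L' : ℕ} (d : ℕ) (X : (Fin L → Bool) → (Fin L' → Bool) → Bool) : Prop :=
  ∀ u, InCPlus d (fun v => X u v)

/-! ### The `𝔽₂` model: `C⁺` and `C` as submodules -/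

/-- Piecewise combination by the residue class of the weight. -/
def pw (q₀ q₁ q₂ : CubeFn (ZMod 2) L) : CubeFn (ZMod 2) L :=
  fun u => if wt u % 3 = 0 then q₀ u else if wt u % 3 = 1 then q₁ u else q₂ u

/-- `pw` is additive. -/
theorem pw_add (q₀ q₁ q₂ r₀ r₁ r₂ : CubeFn (ZMod 2) L) :
    pw q₀ q₁ q₂ + pw r₀ r₁ r₂ = pw (q₀ + r₀) (q₁ + r₁) (q₂ + r₂) := by
  funext u
  simp only [pw, Pi.add_apply]
  split_ifs <;> rfl

/-- `pw` is homogeneous. -/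
theorem pw_smul (c : ZMod 2) (q₀ q₁ q₂ : CubeFn (ZMod 2) L) :
    c • pw q₀ q₁ q₂ = pw (c • q₀) (c • q₁) (c • q₂) := by
  funext u
  simp only [pw, Pi.smul_apply]
  split_ifs <;> rfl

/-- `pw 1 1 1 = 1`. -/
theorem pw_one : pw (1 : CubeFn (ZMod 2) L) 1 1 = 1 := by
  funext u
  simp only [pw, Pi.one_apply]
  split_ifs <;> rfl

/-- **The augmented elimination code `C⁺_L(d)`** as a submodule of `𝔽₂^{{0,1}^L}`. -/
def cplus (L d : ℕ) : Submodule (ZMod 2) (CubeFn (ZMod 2) L) where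
  carrier := {f | ∃ q₀ q₁ q₂ : CubeFn (ZMod 2) L, q₀ ∈ lowDeg (ZMod 2) L d ∧ q₁ ∈ lowDeg (ZMod 2) L d ∧
    q₂ ∈ lowDeg (ZMod 2) L d ∧ (∃ e : ZMod 2, ∀ u, q₀ u + q₁ u + q₂ u = e) ∧ f = pw q₀ q₁ q₂}
  zero_mem' := ⟨0, 0, 0, Submodule.zero_mem _, Submodule.zero_mem _, Submodule.zero_mem _,
    ⟨0, fun u => by simp⟩, by funext u; simp [pw]⟩
  add_mem' := by
    rintro f g ⟨q₀, q₁, q₂, h₀, h₁, h₂, ⟨e, he⟩, rfl⟩ ⟨r₀, r₁, r₂, k₀, k₁, k₂, ⟨e', he'⟩, rfl⟩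
    refine ⟨q₀ + r₀, q₁ + r₁, q₂ + r₂, Submodule.add_mem _ h₀ k₀, Submodule.add_mem _ h₁ k₁,
      Submodule.add_mem _ h₂ k₂, ⟨e + e', fun u => ?_⟩, (pw_add _ _ _ _ _ _)⟩
    simp only [Pi.add_apply]
    rw [← he u, ← he' u]
    ring
  smul_mem' := by
    rintro c f ⟨q₀, q₁, q₂, h₀, h₁, h₂, ⟨e, he⟩, rfl⟩
    refine ⟨c • q₀, c • q₁, c • q₂, Submodule.smul_mem _ c h₀, Submodule.smul_mem _ c h₁,
      Submodule.smul_mem _ c h₂, ⟨c * e, fun u => ?_⟩, pw_smul _ _ _ _⟩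
    simp only [Pi.smul_apply, smul_eq_mul]
    rw [← he u]
    ring

/-- **The elimination code `C_L(d)`**: the pieces sum to `0`. -/
def code (L d : ℕ) : Submodule (ZMod 2) (CubeFn (ZMod 2) L) where
  carrier := {f | ∃ q₀ q₁ q₂ : CubeFn (ZMod 2) L, q₀ ∈ lowDeg (ZMod 2) L d ∧ q₁ ∈ lowDeg (ZMod 2) L d ∧
    q₂ ∈ lowDeg (ZMod 2) L d ∧ (∀ u, q₀ u + q₁ u + q₂ u = 0) ∧ f = pw q₀ q₁ q₂}
  zero_mem' := ⟨0, 0, 0, Submodule.zero_mem _, Submodule.zero_mem _, Submodule.zero_mem _,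
    fun u => by simp, by funext u; simp [pw]⟩
  add_mem' := by
    rintro f g ⟨q₀, q₁, q₂, h₀, h₁, h₂, he, rfl⟩ ⟨r₀, r₁, r₂, k₀, k₁, k₂, he', rfl⟩
    refine ⟨q₀ + r₀, q₁ + r₁, q₂ + r₂, Submodule.add_mem _ h₀ k₀, Submodule.add_mem _ h₁ k₁,
      Submodule.add_mem _ h₂ k₂, fun u => ?_, (pw_add _ _ _ _ _ _)⟩
    simp only [Pi.add_apply]
    have h1 := he u; have h2 := he' u
    linear_combination h1 + h2
  smul_mem' := by
    rintro c f ⟨q₀, q₁, q₂, h₀, h₁, h₂, he, rfl⟩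
    refine ⟨c • q₀, c • q₁, c • q₂, Submodule.smul_mem _ c h₀, Submodule.smul_mem _ c h₁,
      Submodule.smul_mem _ c h₂, fun u => ?_, pw_smul _ _ _ _⟩
    simp only [Pi.smul_apply, smul_eq_mul]
    rw [← mul_add, ← mul_add, he u, mul_zero]

/-- `C ⊆ C⁺`. -/
theorem code_le_cplus (L d : ℕ) : code L d ≤ cplus L d := by
  rintro f ⟨q₀, q₁, q₂, h₀, h₁, h₂, he, rfl⟩
  exact ⟨q₀, q₁, q₂, h₀, h₁, h₂, ⟨0, he⟩, rfl⟩

/-- The constant `1` has degree `0`. -/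
private theorem one_mem_lowDeg₂ (L d : ℕ) : (1 : CubeFn (ZMod 2) L) ∈ lowDeg (ZMod 2) L d := by
  rw [← mono_empty]
  exact mono_mem_lowDeg (by simp)

/-- `𝟙 ∈ C⁺`. -/
theorem one_mem_cplus (L d : ℕ) : (1 : CubeFn (ZMod 2) L) ∈ cplus L d := by
  refine ⟨1, 1, 1, one_mem_lowDeg₂ L d, one_mem_lowDeg₂ L d, one_mem_lowDeg₂ L d, ⟨1, fun u => ?_⟩, ?_⟩
  · show (1 : ZMod 2) + 1 + 1 = 1
    decide
  · funext u; simp [pw]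

/-- **`C⁺ = C ∪ (𝟙 + C)`**: a word of the augmented code lies in the code or in its odd coset. -/
theorem mem_cplus_iff (L d : ℕ) (f : CubeFn (ZMod 2) L) :
    f ∈ cplus L d ↔ (f ∈ code L d ∨ f + 1 ∈ code L d) := by
  constructor
  · rintro ⟨q₀, q₁, q₂, h₀, h₁, h₂, ⟨e, he⟩, rfl⟩
    have he2 : ∀ x : ZMod 2, x = 0 ∨ x = 1 := by decide
    rcases he2 e with rfl | rfl
    · exact Or.inl ⟨q₀, q₁, q₂, h₀, h₁, h₂, he, rfl⟩
    · refine Or.inr ⟨q₀ + 1, q₁ + 1, q₂ + 1, Submodule.add_mem _ h₀ (one_mem_lowDeg₂ L d),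
        Submodule.add_mem _ h₁ (one_mem_lowDeg₂ L d), Submodule.add_mem _ h₂ (one_mem_lowDeg₂ L d),
        fun u => ?_, ?_⟩
      · simp only [Pi.add_apply, Pi.one_apply]
        have h := he u
        have h3 : (1 : ZMod 2) + 1 + 1 + 1 = 0 := by decide
        linear_combination h + h3
      · funext u
        simp only [pw, Pi.add_apply, Pi.one_apply]
        split_ifs <;> rfl
  · rintro (h | h)
    · exact code_le_cplus L d h
    · have : f = (f + 1) + 1 := by
        funext u; simp only [Pi.add_apply, Pi.one_apply]
        have : (1 : ZMod 2) + 1 = 0 := by decide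
        rw [add_assoc, this, add_zero]
      rw [this]
      exact Submodule.add_mem _ (code_le_cplus L d h) (one_mem_cplus L d)

/-! ### The odd coset is heavy under `ElimHard` -/

/-- The decoder naming, from the first two pieces `(x, y) = (q₀(u), q₁(u))` of a codeword, a
residue class whose piece vanishes: `x = 0 ↦ 0`, `(1, 0) ↦ 1`, `(1, 1) ↦ 2` (`q₂ = x + y`). -/
def dec3 (x y : ZMod 2) : ℕ := if x = 0 then 0 else if y = 0 then 1 else 2

/-- The decoder is right only where the named piece vanishes. -/
private theorem piece_zero_of_dec3 (x y z : ZMod 2) (hsum : x + y + z = 0) (t : ℕ)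
    (ht : dec3 x y % 3 = t % 3) :
    (if t % 3 = 0 then x else if t % 3 = 1 then y else z) = 0 := by
  have hz : z = x + y := by
    have : ∀ x y z : ZMod 2, x + y + z = 0 → z = x + y := by decide
    exact this x y z hsum
  subst hz
  unfold dec3 at ht
  have key : ∀ x y : ZMod 2, ∀ r : Fin 3,
      (if x = 0 then 0 else if y = 0 then 1 else 2) % 3 = r.val →
        (if r.val = 0 then x else if r.val = 1 then y else x + y) = 0 := by decide
  exact key x y ⟨t % 3, Nat.mod_lt _ (by norm_num)⟩ ht

/-- **Odd-coset weight under `ElimHard`** (ROUND-1 §9.28(a)): if every degree-`≤ (log₂ n)^C`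
decoder-eliminator on `n ≥ n₀` bits is wrong on `≥ η₀·2ⁿ` inputs, then every `f` with
`f + 𝟙 ∈ C_L(d)`, `d ≤ (log₂ L)^C`, `L ≥ n₀`, takes the value `1` on `≥ η₀·2^L` points. -/
theorem odd_coset_heavy {η₀ : ℝ} {C n₀ : ℕ}
    (hE : ∀ n ≥ n₀, ∀ a b : CubeFn (ZMod 2) n,
      a ∈ lowDeg (ZMod 2) n ((Nat.log 2 n) ^ C) → b ∈ lowDeg (ZMod 2) n ((Nat.log 2 n) ^ C) →
        ∀ dec : ZMod 2 → ZMod 2 → ℕ,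
          η₀ * (2 : ℝ) ^ n ≤ ((univ.filter fun u : Fin n → Bool =>
            dec (a u) (b u) % 3 = Hegedus.wt u % 3).card : ℝ))
    (hL : n₀ ≤ L) {d : ℕ} (hd : d ≤ (Nat.log 2 L) ^ C) {f : CubeFn (ZMod 2) L}
    (hf : f + 1 ∈ code L d) :
    η₀ * (2 : ℝ) ^ L ≤ ((univ.filter fun u : Fin L → Bool => f u = 1).card : ℝ) := by
  obtain ⟨q₀, q₁, q₂, h₀, h₁, _, hsum, hfeq⟩ := hf
  have h := hE L hL q₀ q₁ (lowDeg_mono hd h₀) (lowDeg_mono hd h₁) dec3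
  refine le_trans h ?_
  exact_mod_cast card_le_card fun u hu => by
    have hu' : dec3 (q₀ u) (q₁ u) % 3 = Hegedus.wt u % 3 := (Finset.mem_filter.1 hu).2
    refine Finset.mem_filter.2 ⟨Finset.mem_univ _, ?_⟩
    have hpw : (f + 1) u = pw q₀ q₁ q₂ u := by rw [hfeq]
    have hz := piece_zero_of_dec3 (q₀ u) (q₁ u) (q₂ u) (hsum u) (wt u) hu'
    simp only [Pi.add_apply, Pi.one_apply, pw] at hpw
    rw [hz] at hpw
    have : ∀ x : ZMod 2, x + 1 = 0 → x = 1 := by decide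
    exact this _ hpw

/-- **`𝟙 ∉ C_L(d)`** under `ElimHard` (elimination is never perfect). -/
theorem one_notMem_code {η₀ : ℝ} (hη₀ : 0 < η₀) {C n₀ : ℕ}
    (hE : ∀ n ≥ n₀, ∀ a b : CubeFn (ZMod 2) n,
      a ∈ lowDeg (ZMod 2) n ((Nat.log 2 n) ^ C) → b ∈ lowDeg (ZMod 2) n ((Nat.log 2 n) ^ C) →
        ∀ dec : ZMod 2 → ZMod 2 → ℕ,
          η₀ * (2 : ℝ) ^ n ≤ ((univ.filter fun u : Fin n → Bool =>
            dec (a u) (b u) % 3 = Hegedus.wt u % 3).card : ℝ))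
    (hL : n₀ ≤ L) {d : ℕ} (hd : d ≤ (Nat.log 2 L) ^ C) :
    (1 : CubeFn (ZMod 2) L) ∉ code L d := by
  intro h1
  have h := odd_coset_heavy hE hL hd (f := 0) (by rwa [zero_add])
  have hempty : (univ.filter fun u : Fin L → Bool => (0 : CubeFn (ZMod 2) L) u = 1) = ∅ := by
    ext u; simp
  rw [hempty, card_empty, Nat.cast_zero] at h
  have : (0 : ℝ) < η₀ * 2 ^ L := by positivity
  linarith

/-! ### The parity functional -/

/-- **Parity functional**: if `𝟙 ∉ C` there is a linear functional vanishing on `C` with value `1`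
at `𝟙` (a dual vector of the quotient `𝔽₂^{{0,1}^L} / C`). -/
theorem exists_parity {d : ℕ} (h1 : (1 : CubeFn (ZMod 2) L) ∉ code L d) :
    ∃ φ : CubeFn (ZMod 2) L →ₗ[ZMod 2] ZMod 2, (∀ g ∈ code L d, φ g = 0) ∧ φ 1 = 1 := by
  have hv : (code L d).mkQ 1 ≠ 0 := by
    rwa [Ne, Submodule.mkQ_apply, Submodule.Quotient.mk_eq_zero]
  obtain ⟨ψ, hψ⟩ := Module.Projective.exists_dual_ne_zero (ZMod 2) hv
  refine ⟨ψ.comp (code L d).mkQ, fun g hg => ?_, ?_⟩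
  · rw [LinearMap.comp_apply, Submodule.mkQ_apply, (Submodule.Quotient.mk_eq_zero _).2 hg, map_zero]
  · rw [LinearMap.comp_apply]
    have : ∀ x : ZMod 2, x ≠ 0 → x = 1 := by decide
    exact this _ hψ

/-- On `C⁺` the parity functional detects the code: `φ f = 0 ↔ f ∈ C`. -/
theorem parity_zero_iff {d : ℕ} {φ : CubeFn (ZMod 2) L →ₗ[ZMod 2] ZMod 2}
    (hφ : ∀ g ∈ code L d, φ g = 0) (hφ1 : φ 1 = 1) {f : CubeFn (ZMod 2) L} (hf : f ∈ cplus L d) :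
    φ f = 0 ↔ f ∈ code L d := by
  refine ⟨fun h => ?_, fun h => hφ f h⟩
  rcases (mem_cplus_iff L d f).1 hf with h' | h'
  · exact h'
  · exfalso
    have := hφ _ h'
    rw [map_add, h, hφ1] at this
    exact absurd this (by decide)

/-- On `C⁺` the parity functional detects the odd coset: `φ f = 1 ↔ f + 𝟙 ∈ C`. -/
theorem parity_one_iff {d : ℕ} {φ : CubeFn (ZMod 2) L →ₗ[ZMod 2] ZMod 2}
    (hφ : ∀ g ∈ code L d, φ g = 0) (hφ1 : φ 1 = 1) {f : CubeFn (ZMod 2) L} (hf : f ∈ cplus L d) :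
    φ f = 1 ↔ f + 1 ∈ code L d := by
  rcases (mem_cplus_iff L d f).1 hf with h' | h'
  · have h0 := hφ f h'
    rw [h0]
    refine ⟨fun h => absurd h (by decide), fun h => ?_⟩
    have := hφ _ h
    rw [map_add, h0, hφ1] at this
    exact absurd this (by decide)
  · have := hφ _ h'
    rw [map_add, hφ1] at this
    have hf1 : φ f = 1 := by
      have key : ∀ x : ZMod 2, x + 1 = 0 → x = 1 := by decide
      exact key _ this
    exact ⟨fun _ => h', fun _ => hf1⟩

/-! ### Functionals applied to columns -/

/-- **A functional applied to the columns of a matrix whose rows lie in `S` gives an element of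
`S`**: `φ(col_v) = Σ_u φ(δ_u) · row_u(v)`. -/
theorem functional_of_cols_mem {L L' : ℕ} (S : Submodule (ZMod 2) (CubeFn (ZMod 2) L'))
    (W : (Fin L → Bool) → CubeFn (ZMod 2) L') (hrows : ∀ u, W u ∈ S)
    (φ : CubeFn (ZMod 2) L →ₗ[ZMod 2] ZMod 2) :
    (fun v => φ (fun u => W u v)) ∈ S := by
  classical
  have heq : (fun v => φ (fun u => W u v)) =
      ∑ u : Fin L → Bool, φ (Pi.single u 1) • W u := by
    funext v
    rw [pi_eq_sum_univ' (fun u => W u v), map_sum]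
    simp only [Finset.sum_apply, Pi.smul_apply, map_smul, smul_eq_mul]
    exact Finset.sum_congr rfl fun u _ => mul_comm _ _
  rw [heq]
  exact S.sum_mem fun u _ => S.smul_mem _ (hrows u)

/-- The same identity read as a number: `φ(col_v) = Σ_u row_u(v) · φ(δ_u)`. -/
theorem functional_col_eq_sum {L L' : ℕ} (W : (Fin L → Bool) → CubeFn (ZMod 2) L')
    (φ : CubeFn (ZMod 2) L →ₗ[ZMod 2] ZMod 2) (v : Fin L' → Bool) :
    φ (fun u => W u v) = ∑ u : Fin L → Bool, W u v * φ (Pi.single u 1) := by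
  classical
  rw [pi_eq_sum_univ' (fun u => W u v), map_sum]
  simp only [map_smul, smul_eq_mul]

end Summit.QuantumAdvantage.AdviceFreeQNC0
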